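import Summits.QuantumFields.YangMills.Theorems.IR.AfPincerUcCompactWitness
import Summits.QuantumFields.YangMills.Theorems.BalabanLadderUVSeamRecFloorsCEngine
import HarnessLib

/-!
# Crux `IR` (stmt-QuantumFields-19354), line `af-pincer`, X-side: the R105-COMPACT KIT, II — the PRODUCERS of record deliver
# `LowerBoundsCpt`: the femto package, the unit transfer and the Haar transport of crux `UVSeamRec` (v4-F stubs ⇒ `UVSeamRecCpt`)

Seat ym-19354-afpincer-s2 (generation 4).  Helper module for item `stmt-QuantumFields-19354` (`--supports stmt-QuantumFields-19354 --as helper`;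
it closes nothing).  Sequel of `…IR.AfPincerUcCompactWitness` (R105 (b) compat lemma, `IRCpt`, lane (1)A without envelope ⇒ `IRCpt`).

R105 (a) asks NT-desk concurrence «the floors' witness is a bump BY DECL NAME».  The tree already states every floor it PRODUCES with a compactly
supported witness — `UVSeamRec.FloorsC.lowerBoundsC_twoPoint` (the landed `stub_lower`'s bump, compactness recorded), the unit transfer
`UVSeamRec.UnitTransfer.lowerBounds_of_tendsto_div` (which CONSUMES compact witnesses), the registered v4-F stub `stub_floorsEngine` of crux `UVSeamRec`
(compact-witness `Q2`/`Q3` floors at an engine unit) — and only FORGETS compactness when concluding `LowerBounds`.  This file keeps it: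

* §1 `lowerBoundsCpt_of_femtoPackage` — `(∀β, 0 < aβ) → a → 0 → FBL → FC2 → FC3 → LowerBoundsCpt G r a` (= `stub_lower` with the bump recorded:
  `FloorsC.lowerBoundsC_twoPoint` + `StubLower.lowerBounds_threePoint`).
* §2 the unit transfer in compact currency: `lowerBoundsCpt_of_const_mul` (exact dilation covariance; the dilated bump is compact),
  `lowerBoundsCpt_of_tendsto_div_one` (SAME witness, `UnitTransfer.twoPoint_transfer`), `lowerBoundsCpt_of_tendsto_div`,
  `lowerBoundsCpt_of_tendsto_div_of_momentBounds6`, `lowerBoundsCpt_uRec_of_engine` — mirrors of `UnitTransfer.lowerBounds_*` with `LowerBoundsCpt`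
  in the conclusion.
* §3 Haar transport along `e : G ≃ₜ* H`: `lowerBoundsCpt_pull_iff` (same test functions; `Transport.Q2_pull`/`Q3_pull`), `transportCpt_of_continuousMulEquiv`.
* §4 `UVSeamRecCpt` — the text of `Theses.BalabanLadder.UVSeamRec` with `LowerBoundsCpt` (STRONGER than the registered text:
  `uvSeamRec_of_uvSeamRecCpt`); **`uvSeamRecCpt_of_stubs`**: the two registered v4-F stubs of crux `UVSeamRec` (`stub_ceilings : UV → MomentBounds6 SU(2) rF uRec`,
  `stub_floorsEngine` = compact-witness engine floors at `rF` in a unit `a` with `a/uRec → c₀ > 0`), stated for any fixed `r`, ALREADY give `UVSeamRecCpt`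
  — the `SU(2)`-class producer loses nothing under R105-compact.

HONEST FRAMING.  Bookkeeping (compact support threaded through landed transfers); every floor, ceiling and engine statement is an OPEN hypothesis;
nothing of non-triviality, asymptotic freedom or a gap is proved; CONDITIONAL chain (Track A 0/28 UV); not Clay.  No `sorry`; axioms ⊆ {propext,
Classical.choice, Quot.sound}.
-/

set_option autoImplicit false

noncomputable section

open Filter Topology MeasureTheory
open scoped SchwartzMap
open Literature.MathematicalPhysics.QuantumFieldTheory hiding ZdEdge
open Literature.MathematicalPhysics.QuantumLattice
open Summit.QuantumFields.YangMills.Cruxes.OSLegsFromFemtoAndGap.DlrCollarTransfer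
open Summit.QuantumFields.YangMills.Cruxes.UVSeamRec

namespace Summit.QuantumFields.YangMills.Cruxes.IR.AfPincerUc.Compact

/-! ## §1 The femto package delivers `LowerBoundsCpt` (= `stub_lower`'s witness is a bump, by decl name) -/
section Femto

variable (G : Type) [Group G] [TopologicalSpace G] [IsTopologicalGroup G] [CompactSpace G]
  [MeasurableSpace G] [BorelSpace G] (r : LatticeRep G) (a : ℝ → ℝ)

/-- **The frozen-boundary femto package gives the floors WITH a compactly supported two-point witness:** for a unit map `a > 0`, `a → 0`,
`FBL ∧ FC2 ∧ FC3 ⇒ LowerBoundsCpt G r a` — the landed `stub_lower` (`Statement.stub_lower`, `FBL → FC2 → FC3 → LowerBounds`) with the bump's compact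
support recorded (`UVSeamRec.FloorsC.lowerBoundsC_twoPoint`, same proof as `StubLower.lowerBounds_twoPoint`).  This is R105 (a) in the kernel for the
`dlr-collar-transfer` currency. [folklore] -/
theorem lowerBoundsCpt_of_femtoPackage (hapos : ∀ β, 0 < a β) (hlim : Tendsto a atTop (𝓝 0))
    (hFBL : FBL G r a) (hFC2 : FC2 G r a) (hFC3 : FC3 G r a) : LowerBoundsCpt G r a :=
  ⟨FloorsC.lowerBoundsC_twoPoint G r a hapos hlim hFBL hFC2,
    StubLower.lowerBounds_threePoint G r a hapos hlim hFBL hFC2 hFC3⟩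

/-- The same from `FBL ∧ FC2` for clause (i) and ANY proof of the plain floors for clause (ii). [bookkeeping] -/
theorem lowerBoundsCpt_of_fbl_fc2_of_lowerBounds (hapos : ∀ β, 0 < a β) (hlim : Tendsto a atTop (𝓝 0))
    (hFBL : FBL G r a) (hFC2 : FC2 G r a) (hlb : LowerBounds G r a) : LowerBoundsCpt G r a :=
  ⟨FloorsC.lowerBoundsC_twoPoint G r a hapos hlim hFBL hFC2, hlb.2⟩

end Femto

/-! ## §2 The unit transfer of crux `UVSeamRec` in compact currency -/
section Transfer

variable {G : Type} [Group G] [TopologicalSpace G] [IsTopologicalGroup G] [CompactSpace G]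
  [MeasurableSpace G] [BorelSpace G]

/-- **Exact dilation covariance, compact form: floors at unit `c · a` give floors at unit `a`** (`c > 0`), the dilated two-point bump
`v ∘ (c • ·)` being compactly supported (mirror of `UnitDilation.lowerBounds_of_const_mul`). [folklore] -/
theorem lowerBoundsCpt_of_const_mul (r : LatticeRep G) {a : ℝ → ℝ} {c : ℝ} (hc : 0 < c)
    (h : LowerBoundsCpt G r (fun β => c * a β)) : LowerBoundsCpt G r a := by
  have hplain : LowerBounds G r a := UnitDilation.lowerBounds_of_const_mul r hc (lowerBounds_of_lowerBoundsCpt h)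
  obtain ⟨D, hD⟩ := UnitDilation.exists_dilation c hc.ne'
  obtain ⟨⟨v, ε, β₅, Λ₅, hvK, hv, hε, h2⟩, -⟩ := h
  refine ⟨⟨SchwartzMap.compCLMOfContinuousLinearEquiv ℝ D v, ε, β₅, Λ₅ / c, ?_,
    UnitDilation.tsupport_compCLM_subset_pos D c hD hc hv, hε, fun β hβ L hL => ?_⟩, hplain.2⟩
  · -- compact support is preserved by composition with the homeomorphism `D`
    rw [SchwartzMap.compCLMOfContinuousLinearEquiv_apply]
    exact hvK.comp_homeomorph D.toHomeomorph
  · rw [UnitDilation.Q2_theta_compCLM D c hD]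
    exact h2 β hβ L (by rw [div_le_iff₀ hc] at hL; linarith [hL])

/-- **Floors transfer at ratio one, compact form** (SAME witnesses; `UnitTransfer.twoPoint_transfer` / `threePoint_transfer`): compact-witness floors
at unit `a`, density ceilings at unit `u`, `u → 0⁺`, `a/u → 1` ⇒ `LowerBoundsCpt G r u`. [folklore] -/
theorem lowerBoundsCpt_of_tendsto_div_one (r : LatticeRep G) {a u : ℝ → ℝ} (ha : ∀ β, 0 < a β) (hu : ∀ β, 0 < u β)
    (hu0 : Tendsto u atTop (𝓝 0)) (hau : Tendsto (fun β => a β / u β) atTop (𝓝 1))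
    (hMB : MomentBounds G r u)
    (h2 : ∃ (v : 𝓢(EuclideanSpace ℝ (Fin 4), ℝ)) (ε β₅ Λ₅ : ℝ),
      HasCompactSupport (v : EuclideanSpace ℝ (Fin 4) → ℝ) ∧
      tsupport (v : EuclideanSpace ℝ (Fin 4) → ℝ) ⊆ {y : EuclideanSpace ℝ (Fin 4) | 0 < y 0} ∧ 0 < ε ∧
      ∀ β : ℝ, β₅ ≤ β → ∀ L : ℕ, Λ₅ ≤ a β * L → ε ≤ Q2 G r β L (a β) (thetaTest 4 v) v)
    (h3 : ∃ (f g h : 𝓢(EuclideanSpace ℝ (Fin 4), ℝ)) (ε β₅ Λ₅ : ℝ),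
      HasCompactSupport (f : EuclideanSpace ℝ (Fin 4) → ℝ) ∧ HasCompactSupport (g : EuclideanSpace ℝ (Fin 4) → ℝ) ∧
      HasCompactSupport (h : EuclideanSpace ℝ (Fin 4) → ℝ) ∧
      Disjoint (tsupport (f : EuclideanSpace ℝ (Fin 4) → ℝ)) (tsupport (g : EuclideanSpace ℝ (Fin 4) → ℝ)) ∧
      Disjoint (tsupport (g : EuclideanSpace ℝ (Fin 4) → ℝ)) (tsupport (h : EuclideanSpace ℝ (Fin 4) → ℝ)) ∧
      Disjoint (tsupport (f : EuclideanSpace ℝ (Fin 4) → ℝ)) (tsupport (h : EuclideanSpace ℝ (Fin 4) → ℝ)) ∧ 0 < ε ∧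
      ∀ β : ℝ, β₅ ≤ β → ∀ L : ℕ, Λ₅ ≤ a β * L → ε ≤ |Q3 G r β L (a β) f g h|) :
    LowerBoundsCpt G r u := by
  obtain ⟨v, ε, β₅, Λ₅, hvK, hvpos, hε, hfl⟩ := h2
  obtain ⟨f, g, h, ε', β₅', Λ₅', hfK, hgK, hhK, hfg, hgh, hfh, hε', hfl'⟩ := h3
  obtain ⟨b₂, l₂, H₂⟩ := UnitTransfer.twoPoint_transfer r ha hu hu0 hau hMB v hvK hvpos hε hfl
  obtain ⟨b₃, l₃, H₃⟩ :=
    UnitTransfer.threePoint_transfer r ha hu hu0 hau hMB f g h hfK hgK hhK hfg hgh hfh hε' hfl'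
  exact ⟨⟨v, ε / 2, b₂, l₂, hvK, hvpos, by positivity, H₂⟩,
    ⟨f, g, h, ε' / 2, b₃, l₃, hfg, hgh, hfh, by positivity, H₃⟩⟩

/-- **Floors transfer along an asymptotically proportional unit, compact form:** compact-witness floors at unit `a`, density ceilings at unit `u`,
`u → 0⁺`, `a β / u β → c₀ > 0` ⇒ `LowerBoundsCpt G r u` (mirror of `UnitTransfer.lowerBounds_of_tendsto_div`). [folklore] -/
theorem lowerBoundsCpt_of_tendsto_div (r : LatticeRep G) {a u : ℝ → ℝ} {c₀ : ℝ} (hc₀ : 0 < c₀) (ha : ∀ β, 0 < a β)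
    (hu : ∀ β, 0 < u β) (hu0 : Tendsto u atTop (𝓝 0)) (hau : Tendsto (fun β => a β / u β) atTop (𝓝 c₀))
    (hMB : MomentBounds G r u)
    (h2 : ∃ (v : 𝓢(EuclideanSpace ℝ (Fin 4), ℝ)) (ε β₅ Λ₅ : ℝ),
      HasCompactSupport (v : EuclideanSpace ℝ (Fin 4) → ℝ) ∧
      tsupport (v : EuclideanSpace ℝ (Fin 4) → ℝ) ⊆ {y : EuclideanSpace ℝ (Fin 4) | 0 < y 0} ∧ 0 < ε ∧
      ∀ β : ℝ, β₅ ≤ β → ∀ L : ℕ, Λ₅ ≤ a β * L → ε ≤ Q2 G r β L (a β) (thetaTest 4 v) v)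
    (h3 : ∃ (f g h : 𝓢(EuclideanSpace ℝ (Fin 4), ℝ)) (ε β₅ Λ₅ : ℝ),
      HasCompactSupport (f : EuclideanSpace ℝ (Fin 4) → ℝ) ∧ HasCompactSupport (g : EuclideanSpace ℝ (Fin 4) → ℝ) ∧
      HasCompactSupport (h : EuclideanSpace ℝ (Fin 4) → ℝ) ∧
      Disjoint (tsupport (f : EuclideanSpace ℝ (Fin 4) → ℝ)) (tsupport (g : EuclideanSpace ℝ (Fin 4) → ℝ)) ∧
      Disjoint (tsupport (g : EuclideanSpace ℝ (Fin 4) → ℝ)) (tsupport (h : EuclideanSpace ℝ (Fin 4) → ℝ)) ∧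
      Disjoint (tsupport (f : EuclideanSpace ℝ (Fin 4) → ℝ)) (tsupport (h : EuclideanSpace ℝ (Fin 4) → ℝ)) ∧ 0 < ε ∧
      ∀ β : ℝ, β₅ ≤ β → ∀ L : ℕ, Λ₅ ≤ a β * L → ε ≤ |Q3 G r β L (a β) f g h|) :
    LowerBoundsCpt G r u := by
  have hu' : ∀ β, 0 < c₀ * u β := fun β => mul_pos hc₀ (hu β)
  have hu0' : Tendsto (fun β => c₀ * u β) atTop (𝓝 0) := by
    simpa using hu0.const_mul c₀
  have hau' : Tendsto (fun β => a β / (c₀ * u β)) atTop (𝓝 1) := by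
    have : Tendsto (fun β => c₀⁻¹ * (a β / u β)) atTop (𝓝 (c₀⁻¹ * c₀)) := hau.const_mul c₀⁻¹
    rw [inv_mul_cancel₀ hc₀.ne'] at this
    refine this.congr' (Eventually.of_forall fun β => ?_)
    field_simp
  have hMB' : MomentBounds G r (fun β => c₀ * u β) := (UnitDilation.momentBounds_const_mul_iff r u hc₀).2 hMB
  exact lowerBoundsCpt_of_const_mul r hc₀ (lowerBoundsCpt_of_tendsto_div_one r ha hu' hu0' hau' hMB' h2 h3)

/-- **The same fed by the plane-resolved ceilings** `MomentBounds6 G r u` (the output of `UVSeamRec`'s `stub_ceilings`). [folklore] -/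
theorem lowerBoundsCpt_of_tendsto_div_of_momentBounds6 (r : LatticeRep G) {a u : ℝ → ℝ} {c₀ : ℝ} (hc₀ : 0 < c₀)
    (ha : ∀ β, 0 < a β) (hu : ∀ β, 0 < u β) (hu0 : Tendsto u atTop (𝓝 0))
    (hau : Tendsto (fun β => a β / u β) atTop (𝓝 c₀)) (hMB : MomentBounds6 G r u)
    (h2 : ∃ (v : 𝓢(EuclideanSpace ℝ (Fin 4), ℝ)) (ε β₅ Λ₅ : ℝ),
      HasCompactSupport (v : EuclideanSpace ℝ (Fin 4) → ℝ) ∧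
      tsupport (v : EuclideanSpace ℝ (Fin 4) → ℝ) ⊆ {y : EuclideanSpace ℝ (Fin 4) | 0 < y 0} ∧ 0 < ε ∧
      ∀ β : ℝ, β₅ ≤ β → ∀ L : ℕ, Λ₅ ≤ a β * L → ε ≤ Q2 G r β L (a β) (thetaTest 4 v) v)
    (h3 : ∃ (f g h : 𝓢(EuclideanSpace ℝ (Fin 4), ℝ)) (ε β₅ Λ₅ : ℝ),
      HasCompactSupport (f : EuclideanSpace ℝ (Fin 4) → ℝ) ∧ HasCompactSupport (g : EuclideanSpace ℝ (Fin 4) → ℝ) ∧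
      HasCompactSupport (h : EuclideanSpace ℝ (Fin 4) → ℝ) ∧
      Disjoint (tsupport (f : EuclideanSpace ℝ (Fin 4) → ℝ)) (tsupport (g : EuclideanSpace ℝ (Fin 4) → ℝ)) ∧
      Disjoint (tsupport (g : EuclideanSpace ℝ (Fin 4) → ℝ)) (tsupport (h : EuclideanSpace ℝ (Fin 4) → ℝ)) ∧
      Disjoint (tsupport (f : EuclideanSpace ℝ (Fin 4) → ℝ)) (tsupport (h : EuclideanSpace ℝ (Fin 4) → ℝ)) ∧ 0 < ε ∧
      ∀ β : ℝ, β₅ ≤ β → ∀ L : ℕ, Λ₅ ≤ a β * L → ε ≤ |Q3 G r β L (a β) f g h|) :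
    LowerBoundsCpt G r u :=
  lowerBoundsCpt_of_tendsto_div r hc₀ ha hu hu0 hau
    (Summit.QuantumFields.YangMills.Theorems.OSLegsFromFemtoAndGap.momentBounds_of_momentBounds6 r u hMB) h2 h3

/-- **Compact-witness floors at the unit of record from an engine unit** (mirror of `UnitTransfer.lowerBounds_uRec_of_engine`): compact-witness floors
at a unit `a` with `a β / uRec β → c₀ > 0` and the plane-resolved ceilings at `uRec` give `LowerBoundsCpt G r uRec`. [folklore] -/
theorem lowerBoundsCpt_uRec_of_engine (r : LatticeRep G) {a : ℝ → ℝ} {c₀ : ℝ} (hc₀ : 0 < c₀) (ha : ∀ β, 0 < a β)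
    (hau : Tendsto (fun β => a β / Transport.uRec β) atTop (𝓝 c₀)) (hMB : MomentBounds6 G r Transport.uRec)
    (h2 : ∃ (v : 𝓢(EuclideanSpace ℝ (Fin 4), ℝ)) (ε β₅ Λ₅ : ℝ),
      HasCompactSupport (v : EuclideanSpace ℝ (Fin 4) → ℝ) ∧
      tsupport (v : EuclideanSpace ℝ (Fin 4) → ℝ) ⊆ {y : EuclideanSpace ℝ (Fin 4) | 0 < y 0} ∧ 0 < ε ∧
      ∀ β : ℝ, β₅ ≤ β → ∀ L : ℕ, Λ₅ ≤ a β * L → ε ≤ Q2 G r β L (a β) (thetaTest 4 v) v)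
    (h3 : ∃ (f g h : 𝓢(EuclideanSpace ℝ (Fin 4), ℝ)) (ε β₅ Λ₅ : ℝ),
      HasCompactSupport (f : EuclideanSpace ℝ (Fin 4) → ℝ) ∧ HasCompactSupport (g : EuclideanSpace ℝ (Fin 4) → ℝ) ∧
      HasCompactSupport (h : EuclideanSpace ℝ (Fin 4) → ℝ) ∧
      Disjoint (tsupport (f : EuclideanSpace ℝ (Fin 4) → ℝ)) (tsupport (g : EuclideanSpace ℝ (Fin 4) → ℝ)) ∧
      Disjoint (tsupport (g : EuclideanSpace ℝ (Fin 4) → ℝ)) (tsupport (h : EuclideanSpace ℝ (Fin 4) → ℝ)) ∧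
      Disjoint (tsupport (f : EuclideanSpace ℝ (Fin 4) → ℝ)) (tsupport (h : EuclideanSpace ℝ (Fin 4) → ℝ)) ∧ 0 < ε ∧
      ∀ β : ℝ, β₅ ≤ β → ∀ L : ℕ, Λ₅ ≤ a β * L → ε ≤ |Q3 G r β L (a β) f g h|) :
    LowerBoundsCpt G r Transport.uRec :=
  lowerBoundsCpt_of_tendsto_div_of_momentBounds6 r hc₀ ha UnitTransfer.uRec_pos UnitTransfer.tendsto_uRec hau hMB h2 h3

end Transfer

/-! ## §3 Haar transport along `e : G ≃ₜ* H` in compact currency -/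
section TransportCpt

variable {G H : Type} [Group G] [TopologicalSpace G] [IsTopologicalGroup G] [CompactSpace G]
  [MeasurableSpace G] [BorelSpace G]
  [Group H] [TopologicalSpace H] [IsTopologicalGroup H] [CompactSpace H]
  [MeasurableSpace H] [BorelSpace H]
  (e : G ≃ₜ* H) (r₂ : LatticeRep H)

/-- **`LowerBoundsCpt` transfers along `e`** (same test functions, same constants; `Transport.Q2_pull` / `Q3_pull`). [folklore] -/
theorem lowerBoundsCpt_pull_iff (a : ℝ → ℝ) :
    LowerBoundsCpt G (Transport.pull e r₂) a ↔ LowerBoundsCpt H r₂ a := by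
  simp only [LowerBoundsCpt, Transport.Q2_pull, Transport.Q3_pull]

end TransportCpt

/-- **Unit-generic transport to every `G ≃ₜ* SU(2)`, compact form** (mirror of `Transport.transport_of_continuousMulEquiv`): compact-witness floors ∧
plane-resolved ceilings for some lattice representation of `SU(2)` in unit `a` ⇒ the same for some lattice representation of every compact group
continuously isomorphic to `SU(2)` (the representation `r₂ ∘ e`). [folklore] -/
theorem transportCpt_of_continuousMulEquiv (a : ℝ → ℝ) :
    (letI : MeasurableSpace (Matrix.specialUnitaryGroup (Fin 2) ℂ) := borel _
     haveI : BorelSpace (Matrix.specialUnitaryGroup (Fin 2) ℂ) := ⟨rfl⟩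
     ∃ r₂ : LatticeRep (Matrix.specialUnitaryGroup (Fin 2) ℂ),
       LowerBoundsCpt (Matrix.specialUnitaryGroup (Fin 2) ℂ) r₂ a ∧
         MomentBounds6 (Matrix.specialUnitaryGroup (Fin 2) ℂ) r₂ a) →
    ∀ (G : Type) [Group G] [TopologicalSpace G] [IsTopologicalGroup G] [CompactSpace G],
      IsCompactSimpleLieGroup G → Nonempty (G ≃ₜ* Matrix.specialUnitaryGroup (Fin 2) ℂ) →
      letI : MeasurableSpace G := borel G; haveI : BorelSpace G := ⟨rfl⟩;
      ∃ r : LatticeRep G, LowerBoundsCpt G r a ∧ MomentBounds6 G r a := by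
  intro h G _ _ _ _ _ hne
  obtain ⟨e⟩ := hne
  letI : MeasurableSpace G := borel G
  haveI : BorelSpace G := ⟨rfl⟩
  obtain ⟨r₂, hlb, hmb⟩ := h
  exact ⟨Transport.pull e r₂, (lowerBoundsCpt_pull_iff e r₂ a).2 hlb, (Transport.momentBounds6_pull_iff e r₂ a).2 hmb⟩

/-! ## §4 `UVSeamRecCpt` and its production from the two registered v4-F stubs of crux `UVSeamRec` -/

/-- **`UVSeamRecCpt` — the text of `Theses.BalabanLadder.UVSeamRec` (stmt-QuantumFields-20043) with `LowerBoundsCpt`:** IF Bałaban's apex package holds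
at the datum of record (`UV`) THEN every compact simple `G ≃ₜ* SU(2)` carries ONE lattice representation with COMPACT-witness floors AND the
plane-resolved ceilings in the two-loop unit of record `uRec β = exp (sizeLog β 1)`.  STRONGER than the registered text (`uvSeamRec_of_uvSeamRecCpt`);
already implied by the two registered v4-F stubs (`uvSeamRecCpt_of_stubs`). -/
def UVSeamRecCpt : Prop :=
  Summit.QuantumFields.YangMills.Theses.BalabanLadder.UV →
    ∀ (G : Type) [Group G] [TopologicalSpace G] [IsTopologicalGroup G] [CompactSpace G],
      IsCompactSimpleLieGroup G → Nonempty (G ≃ₜ* Matrix.specialUnitaryGroup (Fin 2) ℂ) →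
      letI : MeasurableSpace G := borel G; haveI : BorelSpace G := ⟨rfl⟩;
      ∃ r : LatticeRep G,
        LowerBoundsCpt G r (fun β => Real.exp (Summit.QuantumFields.YangMills.Theorems.FemtoTransferGap.sizeLog β 1)) ∧
          MomentBounds6 G r (fun β => Real.exp (Summit.QuantumFields.YangMills.Theorems.FemtoTransferGap.sizeLog β 1))

/-- **Monotonicity: `UVSeamRecCpt → UVSeamRec`** (the registered text, by the compat lemma). [bookkeeping] -/
theorem uvSeamRec_of_uvSeamRecCpt (h : UVSeamRecCpt) : Summit.QuantumFields.YangMills.Theses.BalabanLadder.UVSeamRec := by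
  intro hUV G _ _ _ _ hG hcl
  letI : MeasurableSpace G := borel G
  haveI : BorelSpace G := ⟨rfl⟩
  obtain ⟨r, hlbc, hmb⟩ := h hUV G hG hcl
  exact ⟨r, lowerBounds_of_lowerBoundsCpt hlbc, hmb⟩

/-- **The two registered v4-F stubs of crux `UVSeamRec` already give `UVSeamRecCpt`.**  For any fixed lattice representation `r` of `SU(2)` (v4-F: the
fundamental `rF`): the ceilings stub `UV → MomentBounds6 SU(2) r uRec` and the floors-engine stub (a unit `a > 0` with `a/uRec → c₀ > 0` carrying
COMPACT-witness `Q2`/`Q3` floors at `r`) compose through the compact unit transfer (§2) and the compact transport (§3) to `UVSeamRecCpt` — the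
skeleton's own composition `UVSeamRec_of` with compactness kept.  So the R105-compact re-typing of the seam costs the `SU(2)`-class producer nothing.
[kernel composition; both stubs are OPEN] -/
theorem uvSeamRecCpt_of_stubs
    (r : letI : MeasurableSpace (Matrix.specialUnitaryGroup (Fin 2) ℂ) := borel _
      haveI : BorelSpace (Matrix.specialUnitaryGroup (Fin 2) ℂ) := ⟨rfl⟩
      LatticeRep (Matrix.specialUnitaryGroup (Fin 2) ℂ))
    (hceil : letI : MeasurableSpace (Matrix.specialUnitaryGroup (Fin 2) ℂ) := borel _
      haveI : BorelSpace (Matrix.specialUnitaryGroup (Fin 2) ℂ) := ⟨rfl⟩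
      Summit.QuantumFields.YangMills.Theses.BalabanLadder.UV →
        MomentBounds6 (Matrix.specialUnitaryGroup (Fin 2) ℂ) r Transport.uRec)
    (heng : letI : MeasurableSpace (Matrix.specialUnitaryGroup (Fin 2) ℂ) := borel _
      haveI : BorelSpace (Matrix.specialUnitaryGroup (Fin 2) ℂ) := ⟨rfl⟩
      ∃ (a : ℝ → ℝ) (c₀ : ℝ), 0 < c₀ ∧ (∀ β, 0 < a β) ∧
        Tendsto (fun β => a β / Transport.uRec β) atTop (𝓝 c₀) ∧
        (∃ (v : 𝓢(EuclideanSpace ℝ (Fin 4), ℝ)) (ε β₅ Λ₅ : ℝ),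
          HasCompactSupport (v : EuclideanSpace ℝ (Fin 4) → ℝ) ∧
          tsupport (v : EuclideanSpace ℝ (Fin 4) → ℝ) ⊆ {y : EuclideanSpace ℝ (Fin 4) | 0 < y 0} ∧ 0 < ε ∧
          ∀ β : ℝ, β₅ ≤ β → ∀ L : ℕ, Λ₅ ≤ a β * L →
            ε ≤ Q2 (Matrix.specialUnitaryGroup (Fin 2) ℂ) r β L (a β) (thetaTest 4 v) v) ∧
        (∃ (f g h : 𝓢(EuclideanSpace ℝ (Fin 4), ℝ)) (ε β₅ Λ₅ : ℝ),
          HasCompactSupport (f : EuclideanSpace ℝ (Fin 4) → ℝ) ∧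
          HasCompactSupport (g : EuclideanSpace ℝ (Fin 4) → ℝ) ∧
          HasCompactSupport (h : EuclideanSpace ℝ (Fin 4) → ℝ) ∧
          Disjoint (tsupport (f : EuclideanSpace ℝ (Fin 4) → ℝ)) (tsupport (g : EuclideanSpace ℝ (Fin 4) → ℝ)) ∧
          Disjoint (tsupport (g : EuclideanSpace ℝ (Fin 4) → ℝ)) (tsupport (h : EuclideanSpace ℝ (Fin 4) → ℝ)) ∧
          Disjoint (tsupport (f : EuclideanSpace ℝ (Fin 4) → ℝ)) (tsupport (h : EuclideanSpace ℝ (Fin 4) → ℝ)) ∧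
          0 < ε ∧ ∀ β : ℝ, β₅ ≤ β → ∀ L : ℕ, Λ₅ ≤ a β * L →
            ε ≤ |Q3 (Matrix.specialUnitaryGroup (Fin 2) ℂ) r β L (a β) f g h|)) :
    UVSeamRecCpt := by
  intro hUV G _ _ _ _ hG hcl
  letI : MeasurableSpace (Matrix.specialUnitaryGroup (Fin 2) ℂ) := borel _
  haveI : BorelSpace (Matrix.specialUnitaryGroup (Fin 2) ℂ) := ⟨rfl⟩
  have hc := hceil hUV
  obtain ⟨a, c₀, hc₀, ha, hau, h2, h3⟩ := heng
  have hlbc := lowerBoundsCpt_uRec_of_engine r hc₀ ha hau hc h2 h3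
  exact transportCpt_of_continuousMulEquiv Transport.uRec ⟨r, hlbc, hc⟩ G hG hcl

end Summit.QuantumFields.YangMills.Cruxes.IR.AfPincerUc.Compact

end
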